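import Summits.QuantumFields.YangMills.Theorems.BalabanUVNodesPortU8ImagesInfVolStencils
import Summits.QuantumFields.YangMills.Theorems.BalabanUVNodesPortU8LiftWindow

/-!
# Port piece U8 — THE METHOD OF IMAGES, FILE 4a: THE TWO-VOLUME COMPARISON OF ONE PERIODISED KERNEL AT A CENTRED COARSE DIFFERENCE (PORT-PLAN-v4 §4, generic half)
# `|Re Σ_m 𝒦((r − n·w_K) + (nM_K)∘m) − Re Σ_m 𝒦((r − n·w_{K+1}) + (nM_{K+1})∘m)| ≤ 2·M·C·e^{−κ·N_K/4}` — the two volumes' stencils of the whole-torus response at the SAME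
# integer fine position `r` and labels `w_K ≡ w_{K+1} ≡ −z` differ by two TAILS of the periodisation of the real kernel `z′ ↦ Re 𝒦(off r + n·z′)` at `x = blk r + z`

Cell `ym-nodeO-ideate` ∕ `ym-balaban-port`, porter `ymgap-nodeO-port-PTB-1` (gen 5).  JOIN-side helper for **stmt-QuantumFields-27238** (K0ᴬ), `--supports … --as helper`.
[B5] = [Balaban1984PropagatorsI], [I] = [Balaban1987RG1].

WHAT IS PROVED (kernel, sorry-free; `[folklore]` bookkeeping over files 1–3).
§1 `tsum_translate_period` (periodisations are invariant under period shifts of the base point), `periodise_fine_eq_coarse` (the fine-period periodisation at `r − n·w` IS the coarse-period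
   periodisation of `z′ ↦ 𝒦(off r + n·z′)` at `blk r + z` whenever `w + z` is a period), `isPeriod_rep_siteOfInt_neg_add` (the label `Φ(−z)`: `rep(Φ(−z)) + z` is a period),
   `EK_siteOfInt_eq_toT` (the class of `Φ₀(r)` is the fine class of `r` — so the centred coordinates of a fine site serve as its integer position in EVERY volume,
   ✓`liftSiteCtr_eq_siteOfInt`), `two_mul_abs_blk_add_le` (NEAR″ centredness: a source whose block lies in the window of radius `R` about `Φ(−z)`, no wrap, has `2|blk r + z|_i ≤ 2R < N`).
§2 ★★ `abs_re_periodise_sub_le` — THE TWO-VOLUME TAIL BOUND for one kernel with a real-part decay bound `‖Re 𝒦(off r + n·z′)‖ ≤ M e^{−κ|z′|_∞}` (file 3's outputs), periods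
   `M_K ≤ M_{K+1}` coordinatewise, `x` centred in the smaller: `≤ 2·M·C(κ)·e^{−κ·t/4}` for `t ≤ N_K`.

HONEST FRAMING.  Bookkeeping; no Bałaban estimate asserted; 27931 CLOSED·IMPLICATION-ONLY·IN TOTO unchanged; K0ᴬ 27238 OPEN; NODE O 0∕1; COUNT 8∕28 · K 1∕4 UNMOVED; finite `𝕋⁴_{L^K}` at
fixed ε — NOT continuum ∕ OS ∕ Clay; **the Yang–Mills mass gap (Clay) is NOT proved.**
-/

noncomputable section

open scoped BigOperators

namespace Summit.QuantumFields.YangMills.Theorems.PortU8.Images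

open Literature.MathematicalPhysics.QuantumFieldTheory.Balaban1983to89
open Literature.MathematicalPhysics.QuantumFieldTheory.Balaban1983to89.Node00
open Literature.MathematicalPhysics.QuantumFieldTheory.Balaban1983to89.T4Continuum (T4Family)
open Literature.MathematicalPhysics.QuantumFieldTheory.Balaban1983to89.B4ContourShift (supNorm exists_supNorm_eq abs_le_supNorm)
open Literature.MathematicalPhysics.QuantumFieldTheory.Balaban1983to89.B4TorusKernel.MultiPeriod (translate translate_apply)
open Literature.MathematicalPhysics.QuantumFieldTheory.Balaban1983to89.B5Prop11Plancherel (Tor fine)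
open Literature.MathematicalPhysics.QuantumFieldTheory.Balaban1983to89.B5Eq117TorusCarriers (Mk EK EK_apply)
open Literature.MathematicalPhysics.QuantumFieldTheory.Balaban1983to89.B5Eq118OneStroke (iterBlockOf)
open Literature.MathematicalPhysics.QuantumFieldTheory.Balaban1983to89.B6LowerBound2153Torus (toT rep toT_rep isPeriod_rep_toT_sub)
open Literature.MathematicalPhysics.QuantumFieldTheory.Balaban1983to89.B6Lemma24Torus (IsPeriod)
open Summit.QuantumFields.YangMills.Theorems.K0RecordFormatNames

/-! ## §1  Period shifts, the coarse reading of the fine periodisation, the label, the integer position, centredness -/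

/-- **Periodisations are invariant under period shifts of the base point**: `Σ_m K((x + v) + N∘m) = Σ_m K(x + N∘m)` when `N_i ∣ v_i`. [folklore] -/
theorem tsum_translate_period {d : ℕ} (K : (Fin (d + 1) → ℤ) → ℂ) (N : Fin (d + 1) → ℕ) (x v : Fin (d + 1) → ℤ)
    (hv : ∀ i, (N i : ℤ) ∣ v i) :
    ∑' m : Fin (d + 1) → ℤ, K (translate N (x + v) m) = ∑' m : Fin (d + 1) → ℤ, K (translate N x m) := by
  choose q hq using hv
  have e : ∀ m : Fin (d + 1) → ℤ, translate N (x + v) m = translate N x (m + q) := fun m => by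
    funext i; simp only [translate_apply, Pi.add_apply, hq i]; ring
  simp_rw [e]
  exact (Equiv.addRight q).tsum_eq (fun m => K (translate N x m))

/-- **THE FINE PERIODISATION READ ON THE COARSE LATTICE**: if `w + z` is a period of `M`, then `Σ_m 𝒦((r − n·w) + (nM)∘m) = Σ_m 𝒦(off r + n·((blk r + z) + M∘m))`.
[cite: Balaban1984PropagatorsI, (1.18) p.20, p.36 ll.20–23 (bookkeeping)] -/
theorem periodise_fine_eq_coarse (n : ℕ) [NeZero n] (M : Fin (3 + 1) → ℕ) (𝒦 : (Fin (3 + 1) → ℤ) → ℂ) (r w z : Fin (3 + 1) → ℤ)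
    (hwz : ∀ i, (M i : ℤ) ∣ (w + z) i) :
    ∑' m : Fin (3 + 1) → ℤ, 𝒦 (translate (fine n M) (r - (n : ℤ) • w) m) =
      ∑' m : Fin (3 + 1) → ℤ, 𝒦 ((fun j => ((off n r j : ℕ) : ℤ)) + (n : ℤ) • translate M (blk n r + z) m) := by
  have e1 : ∀ m, translate (fine n M) (r - (n : ℤ) • w) m = (fun j => ((off n r j : ℕ) : ℤ)) + (n : ℤ) • translate M (blk n r - w) m := by
    intro m
    rw [translate_fine_eq_offset, show r - (n : ℤ) • w = r + (n : ℤ) • (-w) by rw [smul_neg, sub_eq_add_neg], off_add_nsmul, blk_add_nsmul,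
      ← sub_eq_add_neg]
  simp_rw [e1]
  have e2 : blk n r + z = (blk n r - w) + (w + z) := by abel
  rw [e2]
  exact (tsum_translate_period (fun x => 𝒦 ((fun j => ((off n r j : ℕ) : ℤ)) + (n : ℤ) • x)) M (blk n r - w) (w + z) hwz).symm

variable (F : T4Family)

/-- **The label `Φ(−z)`: `rep(Φ(−z)) + z` is a period** of the coarse torus. [cite: Balaban1987RG1, (1.20)–(1.21) p.264 (bookkeeping)] -/
theorem isPeriod_rep_siteOfInt_neg_add {K k : ℕ} (z : Fin 4 → ℤ) (i : Fin (3 + 1)) :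
    ((Mk (F.P K) (k + 1) i : ℕ) : ℤ) ∣ (rep (d := 3 + 1) (Mk (F.P K) (k + 1)) (siteOfInt F K (k + 1) (-z)) + z) i := by
  have h := isPeriod_rep_toT_sub (Mk (F.P K) (k + 1)) (d := 3 + 1) (fun j => -z j) i
  have e : toT (d := 3 + 1) (Mk (F.P K) (k + 1)) (fun j => -z j) = siteOfInt F K (k + 1) (-z) := by
    funext μ; rfl
  rw [e] at h
  simpa [Pi.sub_apply, Pi.add_apply, sub_neg_eq_add] using h

/-- **The centred coordinates of a fine site serve as its integer position**: `EK (Φ₀ r) = class of r` in the fine torus of [B5] (1.63)'s carriers — in every volume, so the same `r`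
presents a fine site of `T_K` and its centred lift in `T_{K+1}` (✓`liftSiteCtr_eq_siteOfInt`). [cite: Balaban1984PropagatorsI, (1.18) p.20; Balaban1987RG1, (1.21) p.264] -/
theorem EK_siteOfInt_eq_toT {K k : ℕ} (hk : k + 1 ≤ (F.P K).m + (F.P K).K) (r : Fin (3 + 1) → ℤ) :
    EK hk (siteOfInt F K 0 r) = toT (d := 3 + 1) (fine (d := 3 + 1) ((F.P K).L ^ (k + 1)) (Mk (F.P K) (k + 1))) r := by
  funext ν
  rw [EK_apply, siteOfInt_apply, map_intCast]
  rfl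

/-- The block coordinate of a bounded fine coordinate is bounded: `|r| ≤ n·N′ ⇒ |⌊r∕n⌋| ≤ N′`. [folklore] -/
theorem abs_ediv_le {n N' : ℕ} (hn : 0 < n) {r : ℤ} (hr : |r| ≤ (n : ℤ) * N') : |r / (n : ℤ)| ≤ (N' : ℤ) := by
  have hn' : (0 : ℤ) < n := by exact_mod_cast hn
  obtain ⟨h1, h2⟩ := abs_le.1 hr
  rw [abs_le]
  constructor
  · exact Int.le_ediv_of_mul_le hn' (by linarith)
  · have : r / (n : ℤ) < N' + 1 := Int.ediv_lt_of_lt_mul hn' (by linarith)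
    omega

/-- **NEAR″ CENTREDNESS**: for a fine site `x = Φ₀(r)` with `2|r_i| ≤ N₀` whose `(k+1)`-block lies in the window of radius `R` about `Φ(−z)`, under the no-reach condition
`2(|z_i| + R) < N`: `|blk r + z|_i ≤ R`, hence `2|blk r + z|_i < N`. [cite: Balaban1987RG1, (1.21) p.264, p.275 L5–8] -/
theorem abs_blk_add_le_of_mem_window {K k : ℕ} (hk : k + 1 ≤ (F.P K).m + (F.P K).K) (R : ℕ) (z : Fin 4 → ℤ)
    (hc : ∀ i, 2 * (|(-z) i| + R) < ((F.P K).sitesPerDir (k + 1) : ℤ)) (r : Fin (3 + 1) → ℤ)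
    (hr : ∀ i, 2 * |r i| ≤ ((F.P K).sitesPerDir 0 : ℤ))
    (hmem : iterBlockOf (k + 1) (siteOfInt F K 0 r) ∈ recordWindow F k K R (-z)) (i : Fin (3 + 1)) :
    |(blk ((F.P K).L ^ (k + 1)) r + z) i| ≤ R := by
  have hw : ∀ i, 2 * |blk ((F.P K).L ^ (k + 1)) r i| ≤ ((F.P K).sitesPerDir (k + 1) : ℤ) := by
    intro j
    have hN0 : (F.P K).sitesPerDir 0 = (F.P K).L ^ (k + 1) * (2 * (F.P K).L ^ ((F.P K).m + (F.P K).K - (k + 1))) := by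
      simp only [Params.sitesPerDir]
      rw [mul_left_comm, ← pow_add]; congr 2; omega
    have hN1 : ((F.P K).sitesPerDir (k + 1) : ℤ) = 2 * (((F.P K).L ^ ((F.P K).m + (F.P K).K - (k + 1)) : ℕ) : ℤ) := by
      simp only [Params.sitesPerDir]; push_cast; ring
    have h2 := hr j
    rw [hN0] at h2
    push_cast at h2
    have h3 : |r j| ≤ (((F.P K).L ^ (k + 1) : ℕ) : ℤ) * (((F.P K).L ^ ((F.P K).m + (F.P K).K - (k + 1)) : ℕ) : ℤ) := by
      push_cast; nlinarith [abs_nonneg (r j)]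
    have h4 := abs_ediv_le (pow_pos (F.P K).L_pos (k + 1)) h3
    rw [hN1]
    simp only [blk]
    linarith
  have hblk : iterBlockOf (k + 1) (siteOfInt F K 0 r) = siteOfInt F K (k + 1) (blk ((F.P K).L ^ (k + 1)) r) := by
    rw [iterBlockOf_siteOfInt F K (k + 1) hk r]
    congr 1
  rw [hblk] at hmem
  have key := (mem_recordWindow_siteOfInt_iff F k K R (-z) (blk ((F.P K).L ^ (k + 1)) r) hc hw).1 hmem i
  simpa [Pi.add_apply, sub_neg_eq_add] using key

/-! ## §2  ★★ The two-volume tail bound for one kernel -/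

/-- ★★ **THE TWO-VOLUME TAIL BOUND**: let `𝒦` be a fine-position kernel whose real part at the offset of `r` decays, `‖Re 𝒦(off r + n·z′)‖ ≤ M·e^{−κ|z′|_∞}`; let the two
labels satisfy `M_K ∣ w_K + z`, `M_{K+1} ∣ w_{K+1} + z` and let `x = blk r + z` be centred in the smaller torus (`2|x_i| ≤ N_K ≤ N_{K+1}`, `t ≤ N_K`).  Then the real parts of
the two fine periodisations differ by at most `2·M·C(κ)·e^{−κt/4}` (file 1's tail constant). [cite: Balaban1984PropagatorsI, p.36 ll.20–23 (ours); Balaban1987RG1, (1.21) p.264] -/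
theorem abs_re_periodise_sub_le {κ : ℝ} {C : ℝ}
    (hC : ∀ (K : (Fin (3 + 1) → ℤ) → ℂ) (M : ℝ), (∀ y, ‖K y‖ ≤ M * Real.exp (-(κ * supNorm y))) →
      ∀ (N : Fin (3 + 1) → ℕ) (t : ℕ), 1 ≤ t → (∀ i, t ≤ N i) → ∀ x : Fin (3 + 1) → ℤ, (∀ i, 2 * |x i| ≤ N i) →
        Summable (fun m : Fin (3 + 1) → ℤ => K (translate N x m)) ∧
        ‖(∑' m : Fin (3 + 1) → ℤ, K (translate N x m)) - K x‖ ≤ M * C * Real.exp (-(κ * t / 4)))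
    (n : ℕ) [NeZero n] (𝒦 : (Fin (3 + 1) → ℤ) → ℂ) (r : Fin (3 + 1) → ℤ) {Mb : ℝ}
    (hgood : ∀ z' : Fin (3 + 1) → ℤ, ‖(((𝒦 ((fun j => ((off n r j : ℕ) : ℤ)) + (n : ℤ) • z')).re : ℝ) : ℂ)‖ ≤ Mb * Real.exp (-(κ * supNorm z')))
    (hsumK : ∀ (N : Fin (3 + 1) → ℕ), (∀ i, 1 ≤ N i) → ∀ x : Fin (3 + 1) → ℤ,
      Summable (fun m : Fin (3 + 1) → ℤ => 𝒦 ((fun j => ((off n r j : ℕ) : ℤ)) + (n : ℤ) • translate N x m)))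
    (M M' : Fin (3 + 1) → ℕ) (w w' z : Fin (3 + 1) → ℤ) (hw : ∀ i, (M i : ℤ) ∣ (w + z) i) (hw' : ∀ i, (M' i : ℤ) ∣ (w' + z) i)
    (t : ℕ) (ht1 : 1 ≤ t) (ht : ∀ i, t ≤ M i) (ht' : ∀ i, t ≤ M' i)
    (hx : ∀ i, 2 * |(blk n r + z) i| ≤ M i) (hx' : ∀ i, 2 * |(blk n r + z) i| ≤ M' i) :
    |(∑' m : Fin (3 + 1) → ℤ, 𝒦 (translate (fine n M) (r - (n : ℤ) • w) m)).re -
      (∑' m : Fin (3 + 1) → ℤ, 𝒦 (translate (fine n M') (r - (n : ℤ) • w') m)).re| ≤ 2 * (Mb * C * Real.exp (-(κ * t / 4))) := by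
  have hM1 : ∀ i, 1 ≤ M i := fun i => ht1.trans (ht i)
  have hM1' : ∀ i, 1 ≤ M' i := fun i => ht1.trans (ht' i)
  rw [periodise_fine_eq_coarse n M 𝒦 r w z hw, periodise_fine_eq_coarse n M' 𝒦 r w' z hw']
  set Kr : (Fin (3 + 1) → ℤ) → ℂ := fun z' => (((𝒦 ((fun j => ((off n r j : ℕ) : ℤ)) + (n : ℤ) • z')).re : ℝ) : ℂ) with hKr
  have h := norm_periodise_sub_periodise_le (κ := κ) hC Kr hgood ht1 ht ht' (blk n r + z) hx hx'
  have e1 := periodise_re (K := fun z' => 𝒦 ((fun j => ((off n r j : ℕ) : ℤ)) + (n : ℤ) • z')) (N := M) (x := blk n r + z) (hsumK M hM1 _)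
  have e2 := periodise_re (K := fun z' => 𝒦 ((fun j => ((off n r j : ℕ) : ℤ)) + (n : ℤ) • z')) (N := M') (x := blk n r + z) (hsumK M' hM1' _)
  simp only [hKr] at h
  rw [e1, e2, ← Complex.ofReal_sub, Complex.norm_real, Real.norm_eq_abs] at h
  exact h

end Summit.QuantumFields.YangMills.Theorems.PortU8.Images

end
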